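import Literature.AnabelianGeometry.EtaleTheta.Discharge.Sec3Thm37UnitProfinite
import Literature.AnabelianGeometry.EtaleTheta.Discharge.Sec3Thm37UnitsOfDivisorial
import HarnessLib

/-!
# [EtTh] Theorem 3.7 (i) (unit clauses) and (iv) at the canonical MONOID vocabulary `treeMonoidVocab`, for
# ANY category vocabulary `VD` — in particular UNCONDITIONALLY for the constructed data `ofRlfR` / `ofRlfZ`

S. Mochizuki, *The étale theta function and its Frobenioid-theoretic manifestations*, Publ. RIMS **45**
(2009), Theorem 3.7 (i), (iv), PDF pp. 79–80 [cite: MochizukiEtTh2009, Thm 3.7 p.79]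
[cite: MochizukiEtTh2009, Thm 3.7 p.80]; Def. 3.6 (ii), p. 77: "`Φ` … determines a perf-factorial …
monoid on `D`" [cite: MochizukiEtTh2009, Def 3.6 p.77].

PROOF-ONLY sequel (abc-iut cell, F fact-proving wave FLOAT, seat abc-iut-f-047; FACT-LIST rows F-0743
`Thm37_i`, F-0744 `Thm37_iv`) of `Sec3Thm37UnitsOfDivisorial.lean` (same seat; cf. also
`Sec3Thm37UnitProfiniteOfDivisorial.lean`), which needs only "the divisor monoids `Φ(A_D)` are divisorial (resp. sharp)". At the canonical
MONOID vocabulary `treeMonoidVocab` (`FrdIVocabulary.lean`: perf-factorial = the tree's [FrdI] Def. 2.4 (i)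
`IsPerfFactorial`) the field `isPerfFactorial` of Def. 3.6 (ii) makes every `Φ(A)` perf-factorial, hence
divisorial, hence sharp — for EVERY category vocabulary `VD` (cf. `isSharp_carrier_treeMonoidVocab`,
seat abc-iut-w5). The constructed Def. 3.6 (i) data `RealifiedDivisorMonoids.ofRlfR` / `ofRlfZ` / `ofRlfQ`
(abc-iut-L6-t12) live over `treeMonoidVocab`. Hence, for every `VD`:
* `thm37_iv_treeMonoidVocab_of_hdiv` — Thm. 3.7 (iv) from `⋂ₙ O^×(A)ⁿ = 1` alone;
  `thm37_i_unitTrivial_treeMonoidVocab_of_divΛ_injective` / `thm37_iv_treeMonoidVocab_of_divΛ_injective`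
  (`Λ = ℝ`-shape); `thm37_iv_treeMonoidVocab_of_isOfUnitProfiniteType`,
  `isOfUnitProfiniteType_treeMonoidVocab_of_ker`, `thm37_iv_treeMonoidVocab_of_ker` (`Λ = ℤ`-shape);
* **`thm37_i_unitTrivial_ofRlfR_holds`, `thm37_iv_ofRlfR_holds`** — Thm. 3.7 (i) "unit-trivial type" and
  (iv) for EVERY tempered Frobenioid over the constructed `Λ = ℝ` data `ofRlfR`, over ANY `VD`, NO hypothesis
  (supersede the `treeCatVocab`-only `…_ofRlfR_treeCatVocab_holds` and the `(hF)` / `(hBmon)` forms);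
* `thm37_i_unitProfinite_and_iv_ofRlfZ_of_kerIsoPadicUnits` — `Λ = ℤ` data `ofRlfZ`, any `VD`, from the
  Prop. 3.4 (ii) isomorphisms `Ker(B₀(Y_A)^× → (Φ₀^ℝ)^gp) ≅ O_L^×` alone.
No definition; nothing here bears on [IUTchIII] Cor. 3.12; typed ≠ proved elsewhere.
-/

namespace Literature.AnabelianGeometry.EtaleTheta

open CategoryTheory Opposite Literature.AlgebraicGeometry.Frobenioids

universe u₀ v₀ u v w uK

namespace TemperedFrobenioid

section TreeMonoidVocab

variable {D₀ : Type u₀} [Category.{v₀} D₀] {T : RealifiedDivisorMonoids (D₀ := D₀) treeMonoidVocab.{w}}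
  {D : Type u} [Category.{v} D] {VD : FrdICatStub.{u, v, w} D} {p : ℕ} [Fact p.Prime]

/-- At the canonical monoid vocabulary every divisor monoid `Φ(A)` of a tempered Frobenioid is DIVISORIAL,
whatever the category vocabulary `VD`: Def. 3.6 (ii) "`Φ` … determines a perf-factorial … monoid" read in
the tree, and [FrdI] Def. 2.4 (i) perf-factorial ⟹ divisorial. [cite: MochizukiEtTh2009, Def 3.6 p.77] -/
theorem isDivisorial_divisorMonoid_treeMonoidVocab (C₀ : TemperedFrobenioid T D VD) (A : D) :
    IsDivisorial (C₀.divisorMonoid.obj (op A)) :=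
  ((treeMonoidVocab_isPerfFactorial _).mp (C₀.isPerfFactorial (op A))).isDivisorial

/-- **Thm. 3.7 (iv) "`D` slim ⟹ `C` slim" at `treeMonoidVocab`, any `VD`, from `⋂ₙ O^×(A)ⁿ = 1` ALONE.**
[cite: MochizukiEtTh2009, Thm 3.7 p.80] -/
theorem thm37_iv_treeMonoidVocab_of_hdiv (C₀ : TemperedFrobenioid T D VD)
    (hdiv : ∀ (X : C₀.category) (α : Aut X), α ∈ PreFrobenioid.unitsSubgroup C₀.toElem X →
      (∀ n : ℕ+, ∃ β : Aut X, β ∈ PreFrobenioid.unitsSubgroup C₀.toElem X ∧ β ^ (n : ℕ) = α) → α = 1) :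
    C₀.Thm37_iv :=
  C₀.thm37_iv_of_sharp (fun A => (C₀.isDivisorial_divisorMonoid_treeMonoidVocab A).isSharp) hdiv

/-- **Thm. 3.7 (i), "unit-trivial type" at `treeMonoidVocab`, any `VD`**, from the injectivity of
`B₀^Λ → (Φ₀^ℝ)^gp` alone (`Λ = ℝ`-shape). [cite: MochizukiEtTh2009, Thm 3.7 p.79] -/
theorem thm37_i_unitTrivial_treeMonoidVocab_of_divΛ_injective (C₀ : TemperedFrobenioid T D VD)
    (hinj : ∀ A : Dᵒᵖ, Function.Injective (T.divΛ (C₀.baseOp A))) :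
    PreFrobenioid.IsOfType (PreFrobenioid.IsUnitTrivial C₀.toElem) :=
  C₀.thm37_i_unitTrivial_of_isDivisorial C₀.isDivisorial_divisorMonoid_treeMonoidVocab hinj

/-- **Thm. 3.7 (iv) at `treeMonoidVocab`, any `VD`**, from the injectivity of `B₀^Λ → (Φ₀^ℝ)^gp` alone.
[cite: MochizukiEtTh2009, Thm 3.7 p.80] -/
theorem thm37_iv_treeMonoidVocab_of_divΛ_injective (C₀ : TemperedFrobenioid T D VD)
    (hinj : ∀ A : Dᵒᵖ, Function.Injective (T.divΛ (C₀.baseOp A))) : C₀.Thm37_iv :=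
  C₀.thm37_iv_of_isDivisorial_of_divΛ_injective C₀.isDivisorial_divisorMonoid_treeMonoidVocab hinj

/-- **Thm. 3.7 (iv) at `treeMonoidVocab`, any `VD`**, from "unit-profinite type" alone (`Λ = ℤ`-shape).
[cite: MochizukiEtTh2009, Thm 3.7 p.80] -/
theorem thm37_iv_treeMonoidVocab_of_isOfUnitProfiniteType (C₀ : TemperedFrobenioid T D VD)
    (hprof : PreFrobenioid.IsOfUnitProfiniteType C₀.toElem) : C₀.Thm37_iv :=
  C₀.thm37_iv_of_sharp_of_isOfUnitProfiniteType
    (fun A => (C₀.isDivisorial_divisorMonoid_treeMonoidVocab A).isSharp) hprof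

/-- **Thm. 3.7 (i), "unit-profinite type" at `treeMonoidVocab`, any `VD`**, from the kernel datum of (L06)
alone. [cite: MochizukiEtTh2009, Thm 3.7 p.79] -/
theorem isOfUnitProfiniteType_treeMonoidVocab_of_ker (C₀ : TemperedFrobenioid T D VD)
    (hker : ∀ A : Dᵒᵖ, AdmitsTfgProfiniteTopology
      ((T.divΛ (C₀.baseOp A)).comp (Units.coeHom (T.BΛ.obj (C₀.baseOp A)))).ker) :
    PreFrobenioid.IsOfUnitProfiniteType C₀.toElem :=
  C₀.isOfUnitProfiniteType_of_isDivisorial_of_ker C₀.isDivisorial_divisorMonoid_treeMonoidVocab hker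

/-- **Thm. 3.7 (iv) at `treeMonoidVocab`, any `VD`**, from the kernel datum of (L06) alone.
[cite: MochizukiEtTh2009, Thm 3.7 p.80] -/
theorem thm37_iv_treeMonoidVocab_of_ker (C₀ : TemperedFrobenioid T D VD)
    (hker : ∀ A : Dᵒᵖ, AdmitsTfgProfiniteTopology
      ((T.divΛ (C₀.baseOp A)).comp (Units.coeHom (T.BΛ.obj (C₀.baseOp A)))).ker) : C₀.Thm37_iv :=
  C₀.thm37_iv_of_isDivisorial_of_ker C₀.isDivisorial_divisorMonoid_treeMonoidVocab hker

/-- **Thm. 3.7 (i) "unit-profinite type" and (iv) at `treeMonoidVocab`, any `VD`, from the Prop. 3.4 (ii)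
isomorphisms `Ker(B₀^Λ(Y_A)^× → (Φ₀^ℝ)^gp(Y_A)) ≅ O_L^×` alone** (`Λ = ℤ`-shape).
[cite: MochizukiEtTh2009, Thm 3.7 p.80] -/
theorem thm37_i_unitProfinite_and_iv_treeMonoidVocab_of_kerIsoPadicUnits (C₀ : TemperedFrobenioid T D VD)
    (hP34 : ∀ A : Dᵒᵖ, ∃ L : PadicFrd.PadicFld.{uK} p, L.IsPadicLocal ∧
      Nonempty (((T.divΛ (C₀.baseOp A)).comp (Units.coeHom (T.BΛ.obj (C₀.baseOp A)))).ker ≃*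
        PadicFrd.unitSubgroup L.K)) :
    PreFrobenioid.IsOfUnitProfiniteType C₀.toElem ∧ C₀.Thm37_iv := by
  have hprof : PreFrobenioid.IsOfUnitProfiniteType C₀.toElem :=
    C₀.isOfUnitProfiniteType_treeMonoidVocab_of_ker fun A => by
      obtain ⟨L, hL, ⟨e⟩⟩ := hP34 A
      exact AdmitsTfgProfiniteTopology.of_mulEquiv e.symm
        (PadicFrd.PadicFld.admitsTfgProfiniteTopology_unitSubgroup L hL)
  exact ⟨hprof, C₀.thm37_iv_treeMonoidVocab_of_isOfUnitProfiniteType hprof⟩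

end TreeMonoidVocab

/-! ### The constructed data `ofRlfR` (`Λ = ℝ`) and `ofRlfZ` (`Λ = ℤ`), over ANY category vocabulary -/

section OfRlf

variable {D₀ : Type u₀} [Category.{v₀} D₀] (dm : DivisorMonoids.{u₀, v₀, w} D₀)
  (hpf : ∀ Y : D₀ᵒᵖ, IsPerfFactorial (dm.Φ₀.obj Y)) {D : Type u} [Category.{v} D]
  {VD : FrdICatStub.{u, v, w} D} {p : ℕ} [Fact p.Prime]

/-- **Thm. 3.7 (i), "unit-trivial type", for EVERY tempered Frobenioid over the constructed `Λ = ℝ` data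
`ofRlfR`, over any category vocabulary — UNCONDITIONAL.** [cite: MochizukiEtTh2009, Thm 3.7 p.79] -/
theorem thm37_i_unitTrivial_ofRlfR_holds
    (C : TemperedFrobenioid (RealifiedDivisorMonoids.ofRlfR dm hpf) D VD) :
    PreFrobenioid.IsOfType (PreFrobenioid.IsUnitTrivial C.toElem) :=
  C.thm37_i_unitTrivial_ofRlfR_of_isDivisorial dm hpf C.isDivisorial_divisorMonoid_treeMonoidVocab

/-- **Thm. 3.7 (iv) "`D` slim ⟹ `C` slim" for EVERY tempered Frobenioid over the constructed `Λ = ℝ` data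
`ofRlfR`, over any category vocabulary — UNCONDITIONAL** (the named `Prop` `Thm37_iv` with no hypothesis).
[cite: MochizukiEtTh2009, Thm 3.7 p.80] -/
theorem thm37_iv_ofRlfR_holds
    (C : TemperedFrobenioid (RealifiedDivisorMonoids.ofRlfR dm hpf) D VD) :
    Literature.AnabelianGeometry.EtaleTheta.TemperedFrobenioid.Thm37_iv C :=
  C.thm37_iv_ofRlfR_of_isDivisorial dm hpf C.isDivisorial_divisorMonoid_treeMonoidVocab

/-- The two UNIT conjuncts of the typed `Thm37_i F` for `ofRlfR` data, any category vocabulary and ANY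
facade `F` — UNCONDITIONAL (the `Λ = ℤ` conjunct is vacuous). [cite: MochizukiEtTh2009, Thm 3.7 p.79] -/
theorem thm37_i_unitConjuncts_ofRlfR_holds
    (C : TemperedFrobenioid (RealifiedDivisorMonoids.ofRlfR dm hpf) D VD) (F : FrobenioidFacade.{u, v, w} D) :
    (C.monoidType = MonoidType.Z → F.IsOfUnitProfiniteType C.toElem) ∧
      (C.monoidType = MonoidType.R → PreFrobenioid.IsOfType (PreFrobenioid.IsUnitTrivial C.toElem)) :=
  ⟨fun h => absurd ((C.monoidType_ofRlfR dm hpf).symm.trans h) (by decide),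
    fun _ => thm37_i_unitTrivial_ofRlfR_holds dm hpf C⟩

/-- **Thm. 3.7 (i) "unit-profinite type" and (iv) for EVERY tempered Frobenioid over the constructed
`Λ = ℤ` data `ofRlfZ`, any category vocabulary, from the Prop. 3.4 (ii) isomorphisms
`Ker(B₀(Y_A)^× → (Φ₀^ℝ)^gp) ≅ O_L^×` ALONE.** [cite: MochizukiEtTh2009, Thm 3.7 p.80] -/
theorem thm37_i_unitProfinite_and_iv_ofRlfZ_of_kerIsoPadicUnits
    (C : TemperedFrobenioid (RealifiedDivisorMonoids.ofRlfZ dm hpf) D VD)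
    (hP34 : ∀ A : Dᵒᵖ, ∃ L : PadicFrd.PadicFld.{uK} p, L.IsPadicLocal ∧
      Nonempty ((((RealifiedDivisorMonoids.ofRlfZ dm hpf).divΛ (C.baseOp A)).comp
        (Units.coeHom ((RealifiedDivisorMonoids.ofRlfZ dm hpf).BΛ.obj (C.baseOp A)))).ker ≃*
        PadicFrd.unitSubgroup L.K)) :
    PreFrobenioid.IsOfUnitProfiniteType C.toElem ∧ C.Thm37_iv :=
  C.thm37_i_unitProfinite_and_iv_treeMonoidVocab_of_kerIsoPadicUnits hP34

end OfRlf

end TemperedFrobenioid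

end Literature.AnabelianGeometry.EtaleTheta
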